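import Summits.QuantumFields.YangMills.Theorems.FluctuationComparisonRegPrIntLOrganTangentFibreWeightNormalisation
import HarnessLib

/-!
# Route `UnitScaleTilt` — crux `FluctuationComparisonRegPrIntL` (stmt-QuantumFields-20520, rung R3), PATH-B organ: «HÖLDER ALONG THE FIBRE PATH» —
# the interpolated fibre weight `wNum_t = χ·ρ^t·ρ′^{1−t}·J` is the GEOMETRIC interpolation `wNum₁^t · wNum₀^{1−t}` pointwise, so the UN-NORMALISED mass of any event
# under `wNum_t` is at most `(mass under wNum₁)^t · (mass under wNum₀)^{1−t}` — on one fibre (pointwise in the law point `V`) and on any joint measure — uniformly in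
# `t ∈ [0,1]`, with NO Jensen∕KL letter (SPEC (xv-b) «A5 TAIL THRESHOLD» after LEAD RULING №63 «J-EXT STANDS»; UV3-NODE §106 ADDENDUM; desk RULING №111 (c) (i))

Cell `ym3-torus` (YM ladder rung R3 = continuum `SU(2)` Yang–Mills on the three-torus — a RUNG: NOT d = 4, NOT infinite volume, NOT a mass gap, NOT Clay).
Width seat `ym-ust-20520-w4` (gen 27), (xv-b) lane; door-in-waiting GO = LEAD `ym-ust-20520-w3` g29 №1 (3) + ★★OWNER desk g49 RULING №111 (c) + `ym3-torus-px19` g24 №19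
(content notes (i)–(iii)); `--kind proof --supports stmt-QuantumFields-20520 --as helper`, count-neutral, DEFINITION-FREE, no registry ∕ binder ∕ `Lines/` edit, default
heartbeats, `autoImplicit false`.  Companion (next file): `…OrganTangentGoodSetTailJointHolder` (the frame identity + endpoint unconditional masses, §106.1 ∕ ADDENDUM (a)).

WHAT.  In the frame's letters (`mwCut` = the multi-window soft cut `χ`, `wNum_t(V,z) = χ(Φ(V,z))·ρ_Ts(Φ(V,z))^t·ρ′_Ts(Φ(V,z))^{1−t}·J(V,z)` the UN-normalised interpolated
fibre weight, ✓`…RunpairOrganFibreLawDefs`; `wNum₁ = χ·ρ·J` is run `K`'s cut fibre weight, `wNum₀ = χ·ρ′·J` run `K′`'s):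
* §1 [folklore] ★`wNum_eq_rpow_mul_rpow`: `wNum_t = wNum₁^t · wNum₀^{1−t}` POINTWISE, every real `t` (✓p832596 §1 wrote the same path as an exponential tilt
  `wNum₀·e^{t h}`; here the tilt-free form).
* §2 [folklore] `lintegral_ofReal_interp_le`: HÖLDER at exponents `(1∕t, 1∕(1−t))` (Mathlib `ENNReal.lintegral_mul_norm_pow_le`) for any interpolated weight
  `f = f₁^t f₀^{1−t}`, `ℝ≥0∞`-valued integrals of `ofReal` (no integrability bookkeeping), `+ a^t b^{1−t} ≤ max a b`; `measurable_wNum_uncurry`.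
* §3 ON ONE FIBRE, POINTWISE IN THE LAW POINT `V` (px19 №19 (i) ∕ RULING №111 (c)(i)) — any measure `τ` on the fibre, ANY fibre event `G` (no measurability needed),
  `t ∈ [0,1]`: ★`setLIntegral_wNum_le_max` (`ℝ≥0∞` edition) and ★★`setIntegral_wNum_le_rpow_mul_rpow` (REAL edition, Bochner integrals, under integrability of
  `wNum₀(V,·)`, `wNum₁(V,·)` on `G`): `∫_G wNum_t(V,·) dτ ≤ (∫_G wNum₁(V,·) dτ)^t · (∫_G wNum₀(V,·) dτ)^{1−t}`, i.e. `Z_t(V)·tail_t(V) ≤ (Z₁·tail₁)^t·(Z₀·tail₀)^{1−t}`;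
  ★`setIntegral_wNum_le_max_of_window` = the same + `≤ max` in ✓`wgt_normalised`'s binder block at a window point `V` (integrability discharged by ✓`wgt_normalised`).
  J-FREE: the normalisation `ŵ_t = wNum_t ∕ Z_t` is NEVER performed (RULING №63-conform) — contrast ✓`…GoodSetTailAlongPath.setIntegral_wgt_le_max_mul_exp`, whose
  `e^{min(tJ₀,(1−t)J₁)}` is exactly the price of dividing by `Z_t`.  Reusable by any later LOCALISED-tilt road (§106.2).
* §4 ON ANY JOINT MEASURE `ν` on (window fields) × (fibre), any event `E`: ★`setLIntegral_wNum_prod_le_max` — the currency of §106 ADDENDUM (a), where the average is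
  taken against the INTERPOLATED marginal `Z_t(V) dV` (not a run's marginal) and the interpolation costs nothing.

HONEST FRAMING: measure-theoretic [folklore] (one pointwise identity + Hölder) over the frame's HYPOTHESIS letters; NO sup-currency consumer today (A5's Good-set clause is
POINTWISE in the law point `Xw`; the pointwise cell = §106.2's «+ ONE local decoupling input» stays OPEN and is NOT advanced here) — a DOOR-IN-WAITING; nothing of
Bałaban's analysis is asserted or proved; (xv-b) is NOT discharged; `SpreadFibreLawHJ(sq)`(ᴱ) ∕ `OrganDischargeInputsHJ(sq)` (every edition) UNDISCHARGED; the five registered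
stubs of `Lines/runpair_organ.lean` (registry 3732b7df, untouched), crux 20520 and `YM3TorusSU2` are NOT proved; rung R3 = SU(2) YM₃ on T³ at fixed lattice data — NOT d = 4,
NOT infinite volume, NOT a mass gap, NOT Clay; the Yang–Mills mass gap is NOT proved.
-/

set_option autoImplicit false

noncomputable section

namespace Summit.QuantumFields.YangMills.Theorems.OrganTangentGoodSetTailPathHolder

open MeasureTheory Filter Topology
open scoped ENNReal NNReal
open Literature.MathematicalPhysics.QuantumFieldTheory.Balaban1983to89 T3ContinuumYM3Torus T3NestedUnitLaws
  T3UnitLawDensityEML T4Continuum T3UnitScaleTilt T3LevelShift T3TiltDescent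
open Summit.QuantumFields.YangMills.Theorems.FluctuationComparisonRegPrIntLRunpairOrganFibreLaw (mwCut wNum wgt)
open Summit.QuantumFields.YangMills.Theorems.OrganTangentFibreWeightNormalisation (wgt_normalised wNum_nonneg)

/-! ## §1 The path is a geometric interpolation, pointwise -/

/-- ★ `wNum_t = wNum₁^t · wNum₀^{1−t}` pointwise, every real `t` (on the χ-support `(χρJ)^t (χρ′J)^{1−t} = χ ρ^t ρ′^{1−t} J`; off it all three vanish). [folklore] -/
theorem wNum_eq_rpow_mul_rpow (F : T3Family) (γ b₀ p₀ : ℝ) (j Ts : ℕ) (hjTs : j + 1 ≤ Ts)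
    (ρ ρ' : (i : ℕ) → GaugeField (F.P i) 0 ↥(Matrix.specialUnitaryGroup (Fin 2) ℂ) → ℝ)
    (hρpos : ∀ U, PlaqSmall (θBal F.L γ b₀ p₀ Ts) U → 0 < ρ Ts U ∧ 0 < ρ' Ts U) (hθ : 0 < θBal F.L γ b₀ p₀ Ts)
    (hχ0 : ∀ U, 0 ≤ mwCut F γ b₀ p₀ j Ts U)
    (hχsupp : ∀ U, mwCut F γ b₀ p₀ j Ts U ≠ 0 → ∀ (n : ℕ) (hjn : j + 1 ≤ n) (hnK : n ≤ Ts), PlaqSmall (24 / 25 * θBal F.L γ b₀ p₀ n) (descendTo F ℰp n Ts hnK U))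
    {Z : Type} (Φ : GaugeField (F.P j) 0 ↥(Matrix.specialUnitaryGroup (Fin 2) ℂ) × Z → GaugeField (F.P Ts) 0 ↥(Matrix.specialUnitaryGroup (Fin 2) ℂ))
    (J : GaugeField (F.P j) 0 ↥(Matrix.specialUnitaryGroup (Fin 2) ℂ) × Z → ℝ≥0)
    (t : ℝ) (V : GaugeField (F.P j) 0 ↥(Matrix.specialUnitaryGroup (Fin 2) ℂ)) (z : Z) :
    wNum F γ b₀ p₀ j Ts ρ ρ' Φ J t V z = wNum F γ b₀ p₀ j Ts ρ ρ' Φ J 1 V z ^ t * wNum F γ b₀ p₀ j Ts ρ ρ' Φ J 0 V z ^ (1 - t) := by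
  by_cases hχ : mwCut F γ b₀ p₀ j Ts (Φ (V, z)) = 0
  · have h0 : ∀ s : ℝ, wNum F γ b₀ p₀ j Ts ρ ρ' Φ J s V z = 0 := fun s => by simp only [wNum, hχ, zero_mul]
    rw [h0, h0, h0]
    rcases eq_or_ne t 0 with rfl | ht
    · rw [sub_zero, Real.rpow_one, mul_zero]
    · rw [Real.zero_rpow ht, zero_mul]
  · have hW : PlaqSmall (θBal F.L γ b₀ p₀ Ts) (Φ (V, z)) := by
      intro p
      have h := hχsupp _ hχ Ts hjTs le_rfl p
      rw [T3DescentFibreTower.descendTo_self] at h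
      exact lt_of_lt_of_le h (by linarith)
    have hρ := (hρpos _ hW).1
    have hρ' := (hρpos _ hW).2
    have hm : 0 < mwCut F γ b₀ p₀ j Ts (Φ (V, z)) := lt_of_le_of_ne (hχ0 _) (Ne.symm hχ)
    have hJ : 0 ≤ (J (V, z) : ℝ) := NNReal.coe_nonneg _
    set m : ℝ := mwCut F γ b₀ p₀ j Ts (Φ (V, z)) with hmdef
    set a : ℝ := ρ Ts (Φ (V, z)) with hadef
    set b : ℝ := ρ' Ts (Φ (V, z)) with hbdef
    set c : ℝ := (J (V, z) : ℝ) with hcdef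
    have e : ∀ s : ℝ, wNum F γ b₀ p₀ j Ts ρ ρ' Φ J s V z = m * (a ^ s * b ^ (1 - s)) * c := by
      intro s; simp only [wNum, Real.rpow_eq_pow, hmdef, hadef, hbdef, hcdef]
    rw [e, e, e, Real.rpow_one, sub_self, Real.rpow_zero, mul_one, Real.rpow_zero, sub_zero, Real.rpow_one, one_mul,
      Real.mul_rpow (mul_nonneg hm.le hρ.le) hJ, Real.mul_rpow hm.le hρ.le,
      Real.mul_rpow (mul_nonneg hm.le hρ'.le) hJ, Real.mul_rpow hm.le hρ'.le]
    have hm1 : m ^ t * m ^ (1 - t) = m := by rw [← Real.rpow_add hm]; norm_num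
    have hc1 : c ^ t * c ^ (1 - t) = c := by rw [← Real.rpow_add' hJ (by norm_num : t + (1 - t) ≠ 0)]; norm_num
    rw [show m ^ t * a ^ t * c ^ t * (m ^ (1 - t) * b ^ (1 - t) * c ^ (1 - t)) = (m ^ t * m ^ (1 - t)) * (a ^ t * b ^ (1 - t)) * (c ^ t * c ^ (1 - t)) by ring, hm1, hc1]

/-! ## §2 Hölder along an interpolated weight: any measure, any event -/

/-- Hölder at exponents `(1∕t, 1∕(1−t))` for an interpolated real weight `f = f₁^t · f₀^{1−t}` (`f₀, f₁ ≥ 0` measurable, `t ∈ [0,1]`), `ℝ≥0∞`-valued integrals of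
`ofReal`: `∫⁻ f ≤ (∫⁻ f₁)^t · (∫⁻ f₀)^{1−t} ≤ max(∫⁻ f₁, ∫⁻ f₀)` (Mathlib's `ENNReal.lintegral_mul_norm_pow_le` + `a^t b^{1−t} ≤ max a b`). [folklore] -/
theorem lintegral_ofReal_interp_le {X : Type*} [MeasurableSpace X] (ν : Measure X) {f₀ f₁ f : X → ℝ}
    (hf₀ : Measurable f₀) (hf₁ : Measurable f₁) (h₀ : ∀ x, 0 ≤ f₀ x) (h₁ : ∀ x, 0 ≤ f₁ x)
    {t : ℝ} (ht0 : 0 ≤ t) (ht1 : t ≤ 1) (hf : ∀ x, f x = f₁ x ^ t * f₀ x ^ (1 - t)) :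
    ∫⁻ x, ENNReal.ofReal (f x) ∂ν ≤ (∫⁻ x, ENNReal.ofReal (f₁ x) ∂ν) ^ t * (∫⁻ x, ENNReal.ofReal (f₀ x) ∂ν) ^ (1 - t) ∧
      ∫⁻ x, ENNReal.ofReal (f x) ∂ν ≤ max (∫⁻ x, ENNReal.ofReal (f₁ x) ∂ν) (∫⁻ x, ENNReal.ofReal (f₀ x) ∂ν) := by
  have h1t : 0 ≤ 1 - t := by linarith
  have hpt : ∀ x, ENNReal.ofReal (f x) = ENNReal.ofReal (f₁ x) ^ t * ENNReal.ofReal (f₀ x) ^ (1 - t) := by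
    intro x
    rw [hf x, ENNReal.ofReal_mul (Real.rpow_nonneg (h₁ x) _), ENNReal.ofReal_rpow_of_nonneg (h₁ x) ht0,
      ENNReal.ofReal_rpow_of_nonneg (h₀ x) h1t]
  have hmax : ∀ a b : ℝ≥0∞, a ^ t * b ^ (1 - t) ≤ max a b := fun a b =>
    calc a ^ t * b ^ (1 - t) ≤ (max a b) ^ t * (max a b) ^ (1 - t) :=
          mul_le_mul' (ENNReal.rpow_le_rpow (le_max_left a b) ht0) (ENNReal.rpow_le_rpow (le_max_right a b) h1t)
      _ = max a b := by rw [← ENNReal.rpow_add_of_nonneg _ _ ht0 h1t]; norm_num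
  simp_rw [hpt]
  have hH := ENNReal.lintegral_mul_norm_pow_le (μ := ν) hf₁.ennreal_ofReal.aemeasurable hf₀.ennreal_ofReal.aemeasurable ht0 h1t (by ring)
  exact ⟨hH, hH.trans (hmax _ _)⟩

/-- `(V,z) ↦ wNum_s(V,z)` is measurable on (window fields) × (fibre) for every real `s` (χ, `ρ_Ts`, `ρ′_Ts`, `Φ`, `J` measurable). [folklore] -/
theorem measurable_wNum_uncurry (F : T3Family) (γ b₀ p₀ : ℝ) (j Ts : ℕ)
    (ρ ρ' : (i : ℕ) → GaugeField (F.P i) 0 ↥(Matrix.specialUnitaryGroup (Fin 2) ℂ) → ℝ) (hρm : Measurable (ρ Ts)) (hρ'm : Measurable (ρ' Ts))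
    (hχm : Measurable (mwCut F γ b₀ p₀ j Ts)) {Z : Type} [MeasurableSpace Z]
    (Φ : GaugeField (F.P j) 0 ↥(Matrix.specialUnitaryGroup (Fin 2) ℂ) × Z → GaugeField (F.P Ts) 0 ↥(Matrix.specialUnitaryGroup (Fin 2) ℂ))
    (J : GaugeField (F.P j) 0 ↥(Matrix.specialUnitaryGroup (Fin 2) ℂ) × Z → ℝ≥0) (hΦm : Measurable Φ) (hJm : Measurable J) (s : ℝ) :
    Measurable fun p : GaugeField (F.P j) 0 ↥(Matrix.specialUnitaryGroup (Fin 2) ℂ) × Z => wNum F γ b₀ p₀ j Ts ρ ρ' Φ J s p.1 p.2 := by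
  have e : (fun p : GaugeField (F.P j) 0 ↥(Matrix.specialUnitaryGroup (Fin 2) ℂ) × Z => wNum F γ b₀ p₀ j Ts ρ ρ' Φ J s p.1 p.2)
      = fun p => mwCut F γ b₀ p₀ j Ts (Φ p) * (ρ Ts (Φ p) ^ s * ρ' Ts (Φ p) ^ (1 - s)) * (J p : ℝ) := by
    funext p; simp only [wNum, Real.rpow_eq_pow, Prod.mk.eta]
  rw [e]
  exact ((hχm.comp hΦm).mul (((hρm.comp hΦm).pow_const s).mul ((hρ'm.comp hΦm).pow_const (1 - s)))).mul hJm.coe_nnreal_real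

/-! ## §3 On one fibre, pointwise in the law point `V` -/

/-- ★ **HÖLDER ALONG THE PATH ON ONE FIBRE, `ℝ≥0∞` EDITION** (pointwise in the law point `V`; any measure `τ` on the fibre, any fibre event `G`, `t ∈ [0,1]`):
`∫⁻_G wNum_t(V,·) dτ ≤ (∫⁻_G wNum₁(V,·) dτ)^t · (∫⁻_G wNum₀(V,·) dτ)^{1−t} ≤ max(∫⁻_G wNum₁(V,·) dτ, ∫⁻_G wNum₀(V,·) dτ)`.  No normalisation, no `J` letter. [folklore] -/
theorem setLIntegral_wNum_le_max (F : T3Family) (γ b₀ p₀ : ℝ) (j Ts : ℕ) (hjTs : j + 1 ≤ Ts)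
    (ρ ρ' : (i : ℕ) → GaugeField (F.P i) 0 ↥(Matrix.specialUnitaryGroup (Fin 2) ℂ) → ℝ) (hρm : Measurable (ρ Ts)) (hρ'm : Measurable (ρ' Ts))
    (hρpos : ∀ U, PlaqSmall (θBal F.L γ b₀ p₀ Ts) U → 0 < ρ Ts U ∧ 0 < ρ' Ts U) (hθ : 0 < θBal F.L γ b₀ p₀ Ts)
    (hχm : Measurable (mwCut F γ b₀ p₀ j Ts)) (hχ0 : ∀ U, 0 ≤ mwCut F γ b₀ p₀ j Ts U)
    (hχsupp : ∀ U, mwCut F γ b₀ p₀ j Ts U ≠ 0 → ∀ (n : ℕ) (hjn : j + 1 ≤ n) (hnK : n ≤ Ts), PlaqSmall (24 / 25 * θBal F.L γ b₀ p₀ n) (descendTo F ℰp n Ts hnK U))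
    {Z : Type} [MeasurableSpace Z] (τ : Measure Z)
    (Φ : GaugeField (F.P j) 0 ↥(Matrix.specialUnitaryGroup (Fin 2) ℂ) × Z → GaugeField (F.P Ts) 0 ↥(Matrix.specialUnitaryGroup (Fin 2) ℂ))
    (J : GaugeField (F.P j) 0 ↥(Matrix.specialUnitaryGroup (Fin 2) ℂ) × Z → ℝ≥0) (hΦm : Measurable Φ) (hJm : Measurable J)
    (t : ℝ) (ht0 : 0 ≤ t) (ht1 : t ≤ 1) (V : GaugeField (F.P j) 0 ↥(Matrix.specialUnitaryGroup (Fin 2) ℂ)) (G : Set Z) :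
    ∫⁻ z in G, ENNReal.ofReal (wNum F γ b₀ p₀ j Ts ρ ρ' Φ J t V z) ∂τ
        ≤ (∫⁻ z in G, ENNReal.ofReal (wNum F γ b₀ p₀ j Ts ρ ρ' Φ J 1 V z) ∂τ) ^ t * (∫⁻ z in G, ENNReal.ofReal (wNum F γ b₀ p₀ j Ts ρ ρ' Φ J 0 V z) ∂τ) ^ (1 - t) ∧
      ∫⁻ z in G, ENNReal.ofReal (wNum F γ b₀ p₀ j Ts ρ ρ' Φ J t V z) ∂τ
        ≤ max (∫⁻ z in G, ENNReal.ofReal (wNum F γ b₀ p₀ j Ts ρ ρ' Φ J 1 V z) ∂τ) (∫⁻ z in G, ENNReal.ofReal (wNum F γ b₀ p₀ j Ts ρ ρ' Φ J 0 V z) ∂τ) := by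
  have hnn := wNum_nonneg F γ b₀ p₀ j Ts hjTs ρ ρ' hρpos hθ hχ0 hχsupp Φ J
  have hVz : Measurable fun z : Z => ((V, z) : GaugeField (F.P j) 0 ↥(Matrix.specialUnitaryGroup (Fin 2) ℂ) × Z) := measurable_const.prodMk measurable_id
  have hmeas : ∀ s : ℝ, Measurable fun z => wNum F γ b₀ p₀ j Ts ρ ρ' Φ J s V z := by
    intro s
    -- elaborate the composition WITHOUT the expected type (no higher-order unification through `wNum`)
    have h := (measurable_wNum_uncurry F γ b₀ p₀ j Ts ρ ρ' hρm hρ'm hχm Φ J hΦm hJm s).comp hVz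
    exact h
  exact lintegral_ofReal_interp_le (τ.restrict G) (hmeas 0) (hmeas 1) (fun z => hnn 0 V z) (fun z => hnn 1 V z) ht0 ht1
    (fun z => wNum_eq_rpow_mul_rpow F γ b₀ p₀ j Ts hjTs ρ ρ' hρpos hθ hχ0 hχsupp Φ J t V z)

/-- ★★ **HÖLDER ALONG THE PATH ON ONE FIBRE, REAL EDITION** (pointwise in the law point `V`; any measure `τ` on the fibre, ANY fibre event `G`, `t ∈ [0,1]`; under
integrability of the two ENDPOINT weights `wNum₀(V,·)`, `wNum₁(V,·)` on `G` — none is asked of `wNum_t`):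
`∫_G wNum_t(V,·) dτ ≤ (∫_G wNum₁(V,·) dτ)^t · (∫_G wNum₀(V,·) dτ)^{1−t}` — i.e. `Z_t(V)·tail_t(V) ≤ (Z₁(V)·tail₁(V))^t · (Z₀(V)·tail₀(V))^{1−t}` in the
un-normalised currency; the normalisation `ŵ_t = wNum_t ∕ Z_t` is NEVER performed, so NO Jensen-gap ∕ KL ∕ variance letter occurs (RULING №63-conform; the
`e^{min(tJ₀,(1−t)J₁)}` of ✓`…GoodSetTailAlongPath.setIntegral_wgt_le_max_mul_exp` is exactly the price of dividing by `Z_t`).  From the `ℝ≥0∞` edition by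
`ofReal_integral_eq_lintegral_ofReal`. [folklore] -/
theorem setIntegral_wNum_le_rpow_mul_rpow (F : T3Family) (γ b₀ p₀ : ℝ) (j Ts : ℕ) (hjTs : j + 1 ≤ Ts)
    (ρ ρ' : (i : ℕ) → GaugeField (F.P i) 0 ↥(Matrix.specialUnitaryGroup (Fin 2) ℂ) → ℝ) (hρm : Measurable (ρ Ts)) (hρ'm : Measurable (ρ' Ts))
    (hρpos : ∀ U, PlaqSmall (θBal F.L γ b₀ p₀ Ts) U → 0 < ρ Ts U ∧ 0 < ρ' Ts U) (hθ : 0 < θBal F.L γ b₀ p₀ Ts)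
    (hχm : Measurable (mwCut F γ b₀ p₀ j Ts)) (hχ0 : ∀ U, 0 ≤ mwCut F γ b₀ p₀ j Ts U)
    (hχsupp : ∀ U, mwCut F γ b₀ p₀ j Ts U ≠ 0 → ∀ (n : ℕ) (hjn : j + 1 ≤ n) (hnK : n ≤ Ts), PlaqSmall (24 / 25 * θBal F.L γ b₀ p₀ n) (descendTo F ℰp n Ts hnK U))
    {Z : Type} [MeasurableSpace Z] (τ : Measure Z)
    (Φ : GaugeField (F.P j) 0 ↥(Matrix.specialUnitaryGroup (Fin 2) ℂ) × Z → GaugeField (F.P Ts) 0 ↥(Matrix.specialUnitaryGroup (Fin 2) ℂ))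
    (J : GaugeField (F.P j) 0 ↥(Matrix.specialUnitaryGroup (Fin 2) ℂ) × Z → ℝ≥0) (hΦm : Measurable Φ) (hJm : Measurable J)
    (t : ℝ) (ht0 : 0 ≤ t) (ht1 : t ≤ 1) (V : GaugeField (F.P j) 0 ↥(Matrix.specialUnitaryGroup (Fin 2) ℂ)) (G : Set Z)
    (hI1 : IntegrableOn (fun z => wNum F γ b₀ p₀ j Ts ρ ρ' Φ J 1 V z) G τ) (hI0 : IntegrableOn (fun z => wNum F γ b₀ p₀ j Ts ρ ρ' Φ J 0 V z) G τ) :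
    ∫ z in G, wNum F γ b₀ p₀ j Ts ρ ρ' Φ J t V z ∂τ
      ≤ (∫ z in G, wNum F γ b₀ p₀ j Ts ρ ρ' Φ J 1 V z ∂τ) ^ t * (∫ z in G, wNum F γ b₀ p₀ j Ts ρ ρ' Φ J 0 V z ∂τ) ^ (1 - t) := by
  have hnn := wNum_nonneg F γ b₀ p₀ j Ts hjTs ρ ρ' hρpos hθ hχ0 hχsupp Φ J
  have h1t : 0 ≤ 1 - t := by linarith
  have hR1 : 0 ≤ ∫ z in G, wNum F γ b₀ p₀ j Ts ρ ρ' Φ J 1 V z ∂τ := integral_nonneg fun z => hnn 1 V z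
  have hR0 : 0 ≤ ∫ z in G, wNum F γ b₀ p₀ j Ts ρ ρ' Φ J 0 V z ∂τ := integral_nonneg fun z => hnn 0 V z
  have hRHS : 0 ≤ (∫ z in G, wNum F γ b₀ p₀ j Ts ρ ρ' Φ J 1 V z ∂τ) ^ t * (∫ z in G, wNum F γ b₀ p₀ j Ts ρ ρ' Φ J 0 V z ∂τ) ^ (1 - t) :=
    mul_nonneg (Real.rpow_nonneg hR1 _) (Real.rpow_nonneg hR0 _)
  by_cases hIt : Integrable (fun z => wNum F γ b₀ p₀ j Ts ρ ρ' Φ J t V z) (τ.restrict G)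
  · have hL := (setLIntegral_wNum_le_max F γ b₀ p₀ j Ts hjTs ρ ρ' hρm hρ'm hρpos hθ hχm hχ0 hχsupp τ Φ J hΦm hJm t ht0 ht1 V G).1
    rw [← ofReal_integral_eq_lintegral_ofReal hIt (Eventually.of_forall fun z => hnn t V z),
      ← ofReal_integral_eq_lintegral_ofReal hI1 (Eventually.of_forall fun z => hnn 1 V z),
      ← ofReal_integral_eq_lintegral_ofReal hI0 (Eventually.of_forall fun z => hnn 0 V z),
      ENNReal.ofReal_rpow_of_nonneg hR1 ht0, ENNReal.ofReal_rpow_of_nonneg hR0 h1t, ← ENNReal.ofReal_mul (Real.rpow_nonneg hR1 _)] at hL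
    exact (ENNReal.ofReal_le_ofReal_iff hRHS).1 hL
  · rw [integral_undef hIt]; exact hRHS

/-- ★ **… IN THE FRAME'S BINDER BLOCK AT A WINDOW POINT** (binders = ✓`wgt_normalised`'s VERBATIM, then `t ∈ [0,1]`, a window point `V`, ANY fibre event `G`):
integrability of `wNum_s(V,·)` (every `s`) is ✓`wgt_normalised`'s first conjunct, so
`∫_G wNum_t(V,·) dτ ≤ (∫_G wNum₁(V,·) dτ)^t · (∫_G wNum₀(V,·) dτ)^{1−t} ≤ max(∫_G wNum₁(V,·) dτ, ∫_G wNum₀(V,·) dτ)`. [folklore] -/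
theorem setIntegral_wNum_le_max_of_window (F : T3Family) (γ b₀ p₀ : ℝ) (j Ts : ℕ) (hjTs : j + 1 ≤ Ts)
    (ρ ρ' : (i : ℕ) → GaugeField (F.P i) 0 ↥(Matrix.specialUnitaryGroup (Fin 2) ℂ) → ℝ) (hρm : Measurable (ρ Ts)) (hρ'm : Measurable (ρ' Ts))
    (hρc : ContinuousOn (ρ Ts) {U | PlaqSmall (θBal F.L γ b₀ p₀ Ts) U}) (hρ'c : ContinuousOn (ρ' Ts) {U | PlaqSmall (θBal F.L γ b₀ p₀ Ts) U})
    (hρpos : ∀ U, PlaqSmall (θBal F.L γ b₀ p₀ Ts) U → 0 < ρ Ts U ∧ 0 < ρ' Ts U) (hθ : 0 < θBal F.L γ b₀ p₀ Ts)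
    (hχc : Continuous (mwCut F γ b₀ p₀ j Ts)) (hχ0 : ∀ U, 0 ≤ mwCut F γ b₀ p₀ j Ts U)
    (hχsupp : ∀ U, mwCut F γ b₀ p₀ j Ts U ≠ 0 → ∀ (n : ℕ) (hjn : j + 1 ≤ n) (hnK : n ≤ Ts), PlaqSmall (24 / 25 * θBal F.L γ b₀ p₀ n) (descendTo F ℰp n Ts hnK U))
    (hχpos : ∀ U, (∀ (n : ℕ) (hjn : j + 1 ≤ n) (hnK : n ≤ Ts), PlaqSmall (24 / 25 * θBal F.L γ b₀ p₀ n) (descendTo F ℰp n Ts hnK U)) → 0 < mwCut F γ b₀ p₀ j Ts U)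
    {Z : Type} [MeasurableSpace Z] (τ : Measure Z) [IsProbabilityMeasure τ]
    (Φ : GaugeField (F.P j) 0 ↥(Matrix.specialUnitaryGroup (Fin 2) ℂ) × Z → GaugeField (F.P Ts) 0 ↥(Matrix.specialUnitaryGroup (Fin 2) ℂ))
    (J : GaugeField (F.P j) 0 ↥(Matrix.specialUnitaryGroup (Fin 2) ℂ) × Z → ℝ≥0)
    (hΦm : Measurable Φ) (hJm : Measurable J) (CJ : ℝ) (hJle : ∀ V z, (J (V, z) : ℝ) ≤ CJ)
    (hpos : ∀ V, PlaqSmall (θBal F.L γ b₀ p₀ j) V →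
      0 < ∫⁻ z in {z | (∀ (n : ℕ) (hjn : j + 1 ≤ n) (hnK : n ≤ Ts), PlaqSmall (24 / 25 * θBal F.L γ b₀ p₀ n) (descendTo F ℰp n Ts hnK (Φ (V, z))))},
        (J (V, z) : ℝ≥0∞) ∂τ)
    (t : ℝ) (ht0 : 0 ≤ t) (ht1 : t ≤ 1) (V : GaugeField (F.P j) 0 ↥(Matrix.specialUnitaryGroup (Fin 2) ℂ)) (hV : PlaqSmall (θBal F.L γ b₀ p₀ j) V) (G : Set Z) :
    ∫ z in G, wNum F γ b₀ p₀ j Ts ρ ρ' Φ J t V z ∂τ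
        ≤ (∫ z in G, wNum F γ b₀ p₀ j Ts ρ ρ' Φ J 1 V z ∂τ) ^ t * (∫ z in G, wNum F γ b₀ p₀ j Ts ρ ρ' Φ J 0 V z ∂τ) ^ (1 - t) ∧
      ∫ z in G, wNum F γ b₀ p₀ j Ts ρ ρ' Φ J t V z ∂τ
        ≤ max (∫ z in G, wNum F γ b₀ p₀ j Ts ρ ρ' Φ J 1 V z ∂τ) (∫ z in G, wNum F γ b₀ p₀ j Ts ρ ρ' Φ J 0 V z ∂τ) := by
  classical
  haveI : BorelSpace (GaugeField (F.P Ts) 0 ↥(Matrix.specialUnitaryGroup (Fin 2) ℂ)) :=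
    Literature.MathematicalPhysics.QuantumFieldTheory.Balaban1983to89.T3OrbitAverage.instBorelSpaceGaugeField
  have hN := wgt_normalised F γ b₀ p₀ j Ts hjTs ρ ρ' hρm hρ'm hρc hρ'c hρpos hθ hχc hχ0 hχsupp hχpos τ Φ J hΦm hJm CJ hJle hpos
  have hnn := wNum_nonneg F γ b₀ p₀ j Ts hjTs ρ ρ' hρpos hθ hχ0 hχsupp Φ J
  have hI1 : IntegrableOn (fun z => wNum F γ b₀ p₀ j Ts ρ ρ' Φ J 1 V z) G τ := (hN 1 V hV).1.integrableOn
  have hI0 : IntegrableOn (fun z => wNum F γ b₀ p₀ j Ts ρ ρ' Φ J 0 V z) G τ := (hN 0 V hV).1.integrableOn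
  have h := setIntegral_wNum_le_rpow_mul_rpow F γ b₀ p₀ j Ts hjTs ρ ρ' hρm hρ'm hρpos hθ hχc.measurable hχ0 hχsupp τ Φ J hΦm hJm t ht0 ht1 V G hI1 hI0
  have h1t : 0 ≤ 1 - t := by linarith
  set a : ℝ := ∫ z in G, wNum F γ b₀ p₀ j Ts ρ ρ' Φ J 1 V z ∂τ with ha
  set b : ℝ := ∫ z in G, wNum F γ b₀ p₀ j Ts ρ ρ' Φ J 0 V z ∂τ with hb
  have ha0 : 0 ≤ a := integral_nonneg fun z => hnn 1 V z
  have hb0 : 0 ≤ b := integral_nonneg fun z => hnn 0 V z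
  have hm0 : 0 ≤ max a b := le_max_of_le_left ha0
  refine ⟨h, h.trans ?_⟩
  calc a ^ t * b ^ (1 - t) ≤ (max a b) ^ t * (max a b) ^ (1 - t) :=
        mul_le_mul (Real.rpow_le_rpow ha0 (le_max_left _ _) ht0) (Real.rpow_le_rpow hb0 (le_max_right _ _) h1t) (Real.rpow_nonneg hb0 _) (Real.rpow_nonneg hm0 _)
    _ = max a b := by rw [← Real.rpow_add' hm0 (by norm_num : t + (1 - t) ≠ 0)]; norm_num

/-! ## §4 On any joint measure on (window fields) × (fibre) -/

/-- ★ **HÖLDER ALONG THE PATH ON A JOINT MEASURE** (any measure `ν` on (window fields) × (fibre), any event `E`, `t ∈ [0,1]`):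
`∫⁻_E wNum_t dν ≤ (∫⁻_E wNum₁ dν)^t · (∫⁻_E wNum₀ dν)^{1−t} ≤ max(∫⁻_E wNum₁ dν, ∫⁻_E wNum₀ dν)` — the JOINT currency of UV3-NODE §106 ADDENDUM (a): with
`ν = (fieldMeasure_j|_A) ⊗ τ` the left member is the average of the fibre tail against the INTERPOLATED marginal `Z_t(V) dV` (NOT a run's marginal `Z₀ dV` ∕ `Z₁ dV`), in
which the interpolation costs nothing; the companion `…GoodSetTailJointHolder` turns the two right members into ENDPOINT UNCONDITIONAL masses by the frame identity. [folklore] -/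
theorem setLIntegral_wNum_prod_le_max (F : T3Family) (γ b₀ p₀ : ℝ) (j Ts : ℕ) (hjTs : j + 1 ≤ Ts)
    (ρ ρ' : (i : ℕ) → GaugeField (F.P i) 0 ↥(Matrix.specialUnitaryGroup (Fin 2) ℂ) → ℝ) (hρm : Measurable (ρ Ts)) (hρ'm : Measurable (ρ' Ts))
    (hρpos : ∀ U, PlaqSmall (θBal F.L γ b₀ p₀ Ts) U → 0 < ρ Ts U ∧ 0 < ρ' Ts U) (hθ : 0 < θBal F.L γ b₀ p₀ Ts)
    (hχm : Measurable (mwCut F γ b₀ p₀ j Ts)) (hχ0 : ∀ U, 0 ≤ mwCut F γ b₀ p₀ j Ts U)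
    (hχsupp : ∀ U, mwCut F γ b₀ p₀ j Ts U ≠ 0 → ∀ (n : ℕ) (hjn : j + 1 ≤ n) (hnK : n ≤ Ts), PlaqSmall (24 / 25 * θBal F.L γ b₀ p₀ n) (descendTo F ℰp n Ts hnK U))
    {Z : Type} [MeasurableSpace Z]
    (Φ : GaugeField (F.P j) 0 ↥(Matrix.specialUnitaryGroup (Fin 2) ℂ) × Z → GaugeField (F.P Ts) 0 ↥(Matrix.specialUnitaryGroup (Fin 2) ℂ))
    (J : GaugeField (F.P j) 0 ↥(Matrix.specialUnitaryGroup (Fin 2) ℂ) × Z → ℝ≥0) (hΦm : Measurable Φ) (hJm : Measurable J)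
    (ν : Measure (GaugeField (F.P j) 0 ↥(Matrix.specialUnitaryGroup (Fin 2) ℂ) × Z)) (t : ℝ) (ht0 : 0 ≤ t) (ht1 : t ≤ 1)
    (E : Set (GaugeField (F.P j) 0 ↥(Matrix.specialUnitaryGroup (Fin 2) ℂ) × Z)) :
    ∫⁻ p in E, ENNReal.ofReal (wNum F γ b₀ p₀ j Ts ρ ρ' Φ J t p.1 p.2) ∂ν
        ≤ (∫⁻ p in E, ENNReal.ofReal (wNum F γ b₀ p₀ j Ts ρ ρ' Φ J 1 p.1 p.2) ∂ν) ^ t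
          * (∫⁻ p in E, ENNReal.ofReal (wNum F γ b₀ p₀ j Ts ρ ρ' Φ J 0 p.1 p.2) ∂ν) ^ (1 - t) ∧
      ∫⁻ p in E, ENNReal.ofReal (wNum F γ b₀ p₀ j Ts ρ ρ' Φ J t p.1 p.2) ∂ν
        ≤ max (∫⁻ p in E, ENNReal.ofReal (wNum F γ b₀ p₀ j Ts ρ ρ' Φ J 1 p.1 p.2) ∂ν)
              (∫⁻ p in E, ENNReal.ofReal (wNum F γ b₀ p₀ j Ts ρ ρ' Φ J 0 p.1 p.2) ∂ν) := by
  have hnn := wNum_nonneg F γ b₀ p₀ j Ts hjTs ρ ρ' hρpos hθ hχ0 hχsupp Φ J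
  have hmeas := measurable_wNum_uncurry F γ b₀ p₀ j Ts ρ ρ' hρm hρ'm hχm Φ J hΦm hJm
  exact lintegral_ofReal_interp_le (ν.restrict E) (hmeas 0) (hmeas 1) (fun p => hnn 0 p.1 p.2) (fun p => hnn 1 p.1 p.2) ht0 ht1
    (fun p => wNum_eq_rpow_mul_rpow F γ b₀ p₀ j Ts hjTs ρ ρ' hρpos hθ hχ0 hχsupp Φ J t p.1 p.2)

end Summit.QuantumFields.YangMills.Theorems.OrganTangentGoodSetTailPathHolder

end
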